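import Summits.CriticalPhenomena.PercolationContinuityZ3.Theorems.Transplant.SkelSignClosureCentred
import Summits.CriticalPhenomena.PercolationContinuityZ3.Theorems.Transplant.SkelPhiCellsConcGLevels
import HarnessLib

/-!
# D″ L7′.2 — the (Z″) assembly AT THE CELL GEOMETRY OF RECORD `Skelφ.cellGeomSG` (two units, φ-level):
# `Skelφ.concSchemeSG`, `Skelφ.ConcKitAtRunSG`, `Skelφ.theta_pos_of_concKitAtRunSG`, and
# **`PlanarSkeletonSign.samePDropOfSkeletonSign_of_concSG_stepI`** — the D″ node `SamePDropOfSkeletonSign` from the Step-I′ interface of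
# `samePDropOfSkeletonSign_of_stepI_run_centred` (p3-g7, `SkelSignClosureCentred`) with the SIX GEOMETRIC RECORDS DISCHARGED by p2-g7's
# two-unit cell geometry of record (`SkelPhiCellsConcG` p248544 / `SkelPhiCellsConcGLevels` p248610): at every running density the instance
# owes only two-unit planar cells `P : PCells2`, a radius schedule `Λ` with `Skelφ.WFS2 P Λ`, the constants, and the run-restricted
# obligations `KSchA.KitAtRun` at `Skelφ.concSchemeSG` (φ-level twin of `SkelConcAssemblyG`, p234335)

builds on p205010 (kernel theorem, internal audit signed; external expert review pending) — nothing in this file uses p205010.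
Status sentence (coordinator 2026-08-20T04:30Z): "θ(p_c) = 0 on ℤ^d, all d ≥ 2 — kernel-verified (Lean 4/Mathlib, standard axioms); internal adversarial
audit SIGNED 2026-08-20 04:29Z; external expert review pending."
Lane `prim-bschramm-*`, seat `prim-bschramm-stmt` (gen 9); helper file (`--supports stmt-CriticalPhenomena-4575`).
D″ programme (DPRIME-SCOPE §2 L7′, addenda K (φ-level typing contract) and M.3 (order of constants); DPRIME-CHECKLIST DP1/DP3/DP4):
composition of `PlanarSkeletonSign.samePDropOfSkeletonSign_of_stepI_run_centred` (root in base position `Φ.φ t = 0`) with the records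
`Skelφ.runGeomSG / anchGeomSG / sepGeom₂SG / exitGeomSG / stepsGeomSG / levelGeomSG` for `Skelφ.cellGeomSG G φ P t Λ` under
`Skelφ.WFS2 P Λ`, `φ t = 0`, `Skelφ.Lip G φ` and `Skelφ.Steps G φ` (inhabited by the fields `Φ.lip`, `Φ.step`, addendum K.1).

* `Skelφ.concSchemeSG G φ P t Λ q δc := ⟨Skelφ.cellGeomSG G φ P t Λ, q, δc⟩` (anchor type `ℕ`);
* **`Skelφ.ConcKitAtRunSG G φ P t Λ q δc ε' δ₂`** := `KSchA.KitAtRun G (concSchemeSG …) (Skelφ.faceDataSG G φ P t Λ) δ₂ ε'` — the three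
  run-restricted probabilistic obligations (root (32), target lemma at the faces, corridor bound) at the geometry of record: THE target of
  the D″ instance's step (B), split into the residues (R)/(F)/(C) by hp-8 g30's `Skelφ.kitAtRun_of_oblRH` (next file `SkelPhiConcClosureHab`);
* **`Skelφ.theta_pos_of_concKitAtRunSG`** — `WFS2 P Λ`, `φ t = 0`, `Lip`, `Steps`, `0 < q`, `δc ≤ 1`, `ε ≤ 2⁻³²`, `0 ≤ ε'`, `δ₂ ≤ 1`,
  `4((1-δ₂)^K + ε') ≤ ε`, `ConcKitAtRunSG …` ⟹ `0 < θ_t(q)`; `Skelφ.criticalProb_le_of_concKitAtRunSG`;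
* **`PlanarSkeletonSign.samePDropOfSkeletonSign_of_concSG_stepI`** — the hypothesis of `…_of_stepI_run_centred` with its conclusion at `q`
  replaced by `∃ P Λ δc ε' δ₂, Skelφ.WFS2 P Λ ∧ δc ≤ 1 ∧ 0 ≤ ε' ∧ δ₂ ≤ 1 ∧ 4((1-δ₂)^{P.K} + ε') ≤ 2⁻³² ∧ ConcKitAtRunSG G Φ.φ P t Λ q δc ε' δ₂`
  ⟹ `SamePDropOfSkeletonSign`.
[cite: KozmaNitzan2024, §4 Theorem 6 (pp. 25–31); §1 p. 2 (approach 1)] [cite: GrimmettPercolation1999, §7.3 pp. 162, 169]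
-/

noncomputable section

open MeasureTheory ProbabilityTheory
open scoped ENNReal Classical

namespace Summit.CriticalPhenomena.PercolationContinuityZ3.Theorems

namespace Transplant

namespace Skelφ

open Literature.Probability.Percolation Literature.Probability.LatticeModels SimpleGraph KNCells
open BoxProdZ2 (ConcRadiiG)

variable {V : Type} [DecidableEq V] (G : SimpleGraph V) [G.LocallyFinite] (φ : V → Site 2)

/-! ## §1 The scheme and its run-restricted obligations at the two-unit geometry of record -/

/-- **The concentric anchored-cells scheme at density `q` over the planar map `φ`** (cells `Skelφ.cellGeomSG`, two units; chain accuracy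
`δc`). [cite: KozmaNitzan2024, §4 pp. 25–27] -/
abbrev concSchemeSG (P : PCells2) (t : V) (Λ : ConcRadiiG) (q : unitInterval) (δc : ℝ) : KSchA V ℕ :=
  ⟨cellGeomSG G φ P t Λ, q, δc⟩

/-- **The three run-restricted probabilistic obligations at density `q` for `Skelφ.cellGeomSG`** (face data `Skelφ.faceDataSG`): the
generic `KSchA.KitAtRun` at `concSchemeSG`.  THE target of the D″ instance's step (B).
[cite: KozmaNitzan2024, §4 (30), (32), Lemma 10 at the faces, Lemmas 11–12] -/
abbrev ConcKitAtRunSG (P : PCells2) (t : V) (Λ : ConcRadiiG) (q : unitInterval) (δc ε' δ₂ : ℝ) : Prop :=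
  KSchA.KitAtRun G (concSchemeSG G φ P t Λ q δc) (faceDataSG G φ P t Λ) δ₂ ε'

/-! ## §2 The obligations give `θ_t(q) > 0` -/

variable {G φ}

/-- **`ConcKitAtRunSG` at a positive density gives `θ_t(q) > 0`** (p2-g7's six records for `Skelφ.cellGeomSG` from `WFS2 P Λ`, `φ t = 0`,
`Lip`, `Steps`; p5-g3's `KSchA.theta_pos_of_kitAtRun`). [cite: KozmaNitzan2024, §4 Theorem 6 (pp. 25–31)] -/
theorem theta_pos_of_concKitAtRunSG [Countable V] (hlip : Lip G φ) (hstep : Steps G φ) (P : PCells2) (t : V) {Λ : ConcRadiiG}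
    (hΛ : WFS2 P Λ) (hφ : φ t = 0) {q : unitInterval} (hq : 0 < (q : ℝ)) {δc ε ε' δ₂ : ℝ} (hδc : δc ≤ 1) (hε : ε ≤ (1 / 2) ^ 32)
    (hε' : 0 ≤ ε') (hδ₂ : δ₂ ≤ 1) (hKε : 4 * ((1 - δ₂) ^ P.K + ε') ≤ ε) (hkit : ConcKitAtRunSG G φ P t Λ q δc ε' δ₂) :
    0 < theta G t q :=
  KSchA.theta_pos_of_kitAtRun (S := concSchemeSG G φ P t Λ q δc) (runGeomSG P t) (anchGeomSG P t) (sepGeom₂SG P t hΛ hφ hstep)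
    (exitGeomSG P t hΛ hlip) (stepsGeomSG P t hΛ hstep) (levelGeomSG P t hΛ hlip) hδc hε hε' hδ₂ hKε hq hkit

/-- `p_c(G, t) ≤ q` from the obligations at `q > 0`. [cite: KozmaNitzan2024, §1 p. 2 (approach 1)] -/
theorem criticalProb_le_of_concKitAtRunSG [Countable V] (hlip : Lip G φ) (hstep : Steps G φ) (P : PCells2) (t : V) {Λ : ConcRadiiG}
    (hΛ : WFS2 P Λ) (hφ : φ t = 0) {q : unitInterval} (hq : 0 < (q : ℝ)) {δc ε ε' δ₂ : ℝ} (hδc : δc ≤ 1) (hε : ε ≤ (1 / 2) ^ 32)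
    (hε' : 0 ≤ ε') (hδ₂ : δ₂ ≤ 1) (hKε : 4 * ((1 - δ₂) ^ P.K + ε') ≤ ε) (hkit : ConcKitAtRunSG G φ P t Λ q δc ε' δ₂) :
    criticalProb G t ≤ q :=
  OrbitQuotient.criticalProb_le_of_theta_pos _ _ q (theta_pos_of_concKitAtRunSG hlip hstep P t hΛ hφ hq hδc hε hε' hδ₂ hKε hkit)

end Skelφ

namespace PlanarSkeletonSign

open Literature.Probability.Percolation Literature.Probability.LatticeModels SimpleGraph KNCells
open Literature.Barriers.CriticalPhenomena (HasExponentialGrowth)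
open BoxProdZ2 (ConcRadiiG)

/-! ## §3 The D″ node from the Step-I′ interface at the geometry of record -/

/-- **THE D″ (Z″) ASSEMBLY at `Skelφ.cellGeomSG`** (root in base position `Φ.φ t = 0`): suppose that for every locally finite `G` NOT of
exponential growth with a `PlanarSkeletonSign Φ`, every `t ∈ Φ.types` with `Φ.φ t = 0`, every `0 < p < 1` with a.s. uniqueness, Φ2 (`hC`)
and `θ_t(p) > 0`, the instance names `δI > 0` and `m₀`, then — handed Step-I′ data `D, off, M₀, n₁` with the seven facts — returns
admissible finite lists `Sz Sx Sy`, and at every `q ∈ [p/2, p]` where the Step-I′ family over them holds with accuracy `δI` and Φ2 holds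
supplies two-unit planar cells `P`, a schedule `Λ` with `Skelφ.WFS2 P Λ`, constants and `Skelφ.ConcKitAtRunSG G Φ.φ P t Λ q δc ε' δ₂`.
Then `SamePDropOfSkeletonSign` (via `samePDropOfSkeletonSign_of_stepI_run_centred`; the six records from `Φ.lip`, `Φ.step`).
[cite: KozmaNitzan2024, §1 p. 2 (approach 1), §4 Theorem 6 (pp. 25–31)] -/
theorem samePDropOfSkeletonSign_of_concSG_stepI
    (h : ∀ {V : Type} [DecidableEq V] [Countable V] (G : SimpleGraph V) [G.LocallyFinite] (Φ : PlanarSkeletonSign G),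
      ¬ HasExponentialGrowth G → ∀ t ∈ Φ.types, Φ.φ t = 0 → ∀ p : unitInterval, 0 < (p : ℝ) → (p : ℝ) < 1 →
        (∀ᵐ ω ∂bondPercolation G p, numInfiniteClusters ω ≤ 1) → ∀ hC : Φ.CylSubcritical p, 0 < theta G t p →
          ∃ (δI : ℝ) (m₀ : ℕ), 0 < δI ∧
            ∀ (D : Skelφ.StepI.Data V) (off M₀ n₁ : ℕ), m₀ ≤ D.k → 1 ≤ D.k → D.R = Skelφ.fatRadius Φ.frame hC →
              D.Λ = Skelφ.fatSeqOff Φ.frame hC off → D.k < M₀ → D.k < n₁ → (∀ ℓ, D.k ≤ D.Gb ℓ ∧ D.k ≤ D.Fb ℓ) →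
              ∃ Sz Sx Sy : Finset ℕ, (∀ M ∈ Sz, M₀ ≤ M) ∧ (∀ ℓ ∈ Sx, n₁ ≤ ℓ) ∧ (∀ ℓ ∈ Sy, n₁ ≤ ℓ) ∧
                ∀ q : unitInterval, (p : ℝ) / 2 ≤ q → (q : ℝ) ≤ p →
                  (∀ i ∈ Skelφ.StepI.index Φ.types Sz Sx Sy,
                    1 - δI < (bondPercolation G q).real (Skelφ.StepI.event G Φ.φ D i)) →
                  Φ.CylSubcritical q →
                    ∃ (P : PCells2) (Λ : ConcRadiiG) (δc ε' δ₂ : ℝ), Skelφ.WFS2 P Λ ∧ δc ≤ 1 ∧ 0 ≤ ε' ∧ δ₂ ≤ 1 ∧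
                      4 * ((1 - δ₂) ^ P.K + ε') ≤ (1 / 2) ^ 32 ∧ Skelφ.ConcKitAtRunSG G Φ.φ P t Λ q δc ε' δ₂) :
    SamePDropOfSkeletonSign := by
  refine samePDropOfSkeletonSign_of_stepI_run_centred fun {V} _ _ G _ Φ hg t ht h0 p hp0 hp1 hU hC hθ => ?_
  obtain ⟨δI, m₀, hδI, hB⟩ := h G Φ hg t ht h0 p hp0 hp1 hU hC hθ
  refine ⟨δI, m₀, hδI, fun D off M₀ n₁ hk₀ hk₁ hR hΛ hM₀ hn₁ hGF => ?_⟩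
  obtain ⟨Sz, Sx, Sy, hSz, hSx, hSy, hq⟩ := hB D off M₀ n₁ hk₀ hk₁ hR hΛ hM₀ hn₁ hGF
  refine ⟨Sz, Sx, Sy, hSz, hSx, hSy, fun q hq1 hq2 hcq hCq => ?_⟩
  obtain ⟨P, Λ, δc, ε', δ₂, hWF, hδc, hε', hδ₂, hKε, hkit⟩ := hq q hq1 hq2 hcq hCq
  exact ⟨ℕ, Skelφ.concSchemeSG G Φ.φ P t Λ q δc, Skelφ.faceDataSG G Φ.φ P t Λ, Skelφ.levelDataS Φ.φ P, ε', δ₂, rfl, rfl,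
    Skelφ.runGeomSG P t, Skelφ.anchGeomSG P t, Skelφ.sepGeom₂SG P t hWF h0 Φ.step, Skelφ.exitGeomSG P t hWF Φ.lip,
    Skelφ.stepsGeomSG P t hWF Φ.step, Skelφ.levelGeomSG P t hWF Φ.lip, hδc, hε', hδ₂, hKε, hkit⟩

end PlanarSkeletonSign

end Transplant

end Summit.CriticalPhenomena.PercolationContinuityZ3.Theorems

end
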